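import Literature.MathematicalPhysics.QuantumFieldTheory.Balaban1983to89.B8BlockConstantLiftDataRec
import Literature.MathematicalPhysics.QuantumFieldTheory.TiltedExponentMorseBounds

/-!
# `Balaban1983to89.B8ExpMeanLogCrossTermRec` — [Balaban1985Averaging] (78): the one-step `exp[mean log]` average is MULTIPLICATIVE UP TO SECOND ORDER —
# `‖R̄₀(a·u)(y) − R̄₀(a)(y)·R̄₀(u)(y)‖ ≤ 16·(p + q)²` for near-constant `U1`-valued `a` (oscillation `p`) and `u` (oscillation `q`): the supplier of the displayed second-order
# defect `ψ₂` of road (B′)'s row 9′ (director-ym №311∕№312∕№312a branch (ii), case (β)) — item (B′-5)′ of the plan's envelope, ONE-STEP form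

statement-level skeleton of published theorems with citation tags; proofs where landed; nothing here is a claim about the Yang–Mills mass gap

CITATION HEADER (lean-in-tree rule).  Cell `pub-ymgap` (HUMAN RULING D-0062), «N05-REC» road; director-ym №312a: envelope item (ii) += «(B′-5)′ cross-term bound
‖R̄ʲ(a·u)(y) − R̄ʲ(a)(y)·R̄ʲ(u)(y)‖ ≤ C·(…)² (M, n05-e) — the ONE genuine elementary ESTIMATE of road (B′)».  THIS FILE proves the ONE-STEP ((78), one block, trivial transporters)
form with the explicit constant `16` and smallness `p, q ≤ 1∕8`; the tower form (induction along `Rbar_succ` with per-level oscillation bounds) is the sequel.  Pen dag-n05-e g41.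
[3] = [Balaban1985Averaging] (78) p. 30, (21) p. 21; [15] = [Balaban1985Variational] (100) p. 47; [6] = [Balaban1985RegularSpaces] (1.29) p. 81.  `--kind proof --supports
stmt-QuantumFields-20541` (K0⁷; count-neutral; no definition).  REUSED BY NAME: `B7Eq78Linearization.{avgStep, avgStep_eq_mul_exp_sum, conjR_apply}`, `MatrixLog.{mlog, mlog_def}`,
`Literature.Analysis.Complex.{logOnePlus, summable_logOnePlus, logSeriesCoeff, norm_logSeriesCoeff_smul_pow_le, norm_logOnePlus_le_two_mul}`, `B7Prop6Flat.logOnePlus_conj`,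
`OneLinkLaplace.norm_exp_sub_one_sub_le_sq` (TiltedExponentMorseBounds), Mathlib `NormedSpace.exp_units_conj'`,
`Real.abs_exp_sub_one_sub_id_le`.

THE MATHEMATICS.  With `α_x = a(y)⁻¹a(x) − 1`, `β_x = u(y)⁻¹u(x) − 1`, `α′ = u(y)⁻¹αu(y)`: `(a(y)u(y))⁻¹a(x)u(x) = (1 + α′_x)(1 + β_x)`, so
`R̄₀(a·u)(y) = a(y)u(y)·exp[Σ w_x log((1+α′_x)(1+β_x))]` while `R̄₀(a)(y)·R̄₀(u)(y) = a(y)u(y)·exp[u(y)⁻¹Au(y)]·exp[B]`, `A = Σ w log(1+α)`, `B = Σ w log(1+β)`; both exponents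
agree to first order (`Σ w(α′ + β)`), and every second-order remainder (`log(1+x) − x`, `e^x − 1 − x`, the product `α′β`, `A′B`) is `≤ const·(p+q)²`.
WHAT IS PROVED (sorry-free).  §1 `norm_logOnePlus_sub_self_le` (`‖log(1+x) − x‖ ≤ 2‖x‖²`, `‖x‖ ≤ 1∕2`), `norm_exp_sub_one_le'` (from the landed `‖eˣ − 1 − x‖ ≤ ‖x‖²`),
`norm_wsum_le` (weighted means with nonnegative weights of total mass `1`); §2 `norm_wsum_log_cross_le` (logarithmic side, `5(p+q)²`), `norm_exp_sub_exp_mul_exp_le` (exponential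
side, `16(p+q)²`); §3 ★★★ `norm_avgStep_mul_sub_mul_le` — the one-step cross-term bound with constant `16`.
HONEST SCOPE.  An elementary Banach-algebra estimate (ours, under №310's licence line — NOT a printed clause of [3]∕[6]∕[15]); the tower version and its insertion into the crown's row 9′
are separate files; `HThm4Rec*` CONDITIONAL; N05 DISCHARGED OF RECORD since R467 (count-neutral record-level work), N07 NOT discharged; counts unmoved (typed 28∕28 · discharged 8∕28);
one finite 𝕋⁴ programme at fixed ε, `G = SU(2)` of record — nothing continuum ∕ ℝ⁴ ∕ OS ∕ mass gap ∕ Clay.  No `def`, no `instance`, no `notation`, no `sorry`.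
-/

set_option autoImplicit false

noncomputable section

open scoped BigOperators

namespace Literature.MathematicalPhysics.QuantumFieldTheory.Balaban1983to89.B8ExpMeanLogCrossTermRec

open NormedSpace
open Literature.Analysis.Complex (logOnePlus summable_logOnePlus logSeriesCoeff norm_logSeriesCoeff_smul_pow_le norm_logOnePlus_le_two_mul logSeriesCoeff_zero)
open MatrixLog (mlog mlog_def)
open B7Eq78Linearization (avgStep avgStep_eq_mul_exp_sum conjR conjR_apply)

variable {𝔸 : Type*} [NormedRing 𝔸] [NormOneClass 𝔸] [NormedAlgebra ℂ 𝔸] [CompleteSpace 𝔸]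

/-! ## §1  Second-order remainders and weighted means -/

omit [NormOneClass 𝔸] in
/-- `logSeriesCoeff 1 = 1`. [folklore] -/
private theorem logSeriesCoeff_one : logSeriesCoeff 1 = 1 := by
  simp [logSeriesCoeff]

omit [NormOneClass 𝔸] in
/-- **`‖log(1 + x) − x‖ ≤ 2‖x‖²` for `‖x‖ ≤ 1∕2`** (the series from the quadratic term on: `Σ_{n≥2} ‖x‖ⁿ = ‖x‖²∕(1 − ‖x‖)`). [cite: Balaban1985Averaging, (21) p.21 (the power series)] -/
theorem norm_logOnePlus_sub_self_le {x : 𝔸} (hx : ‖x‖ ≤ 1 / 2) : ‖logOnePlus x - x‖ ≤ 2 * ‖x‖ ^ 2 := by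
  have hx1 : ‖x‖ < 1 := hx.trans_lt (by norm_num)
  have hs := summable_logOnePlus hx1
  have h0 : logOnePlus x = ∑' n : ℕ, logSeriesCoeff n • x ^ n := rfl
  have h2 : logOnePlus x - x = ∑' n : ℕ, logSeriesCoeff (n + 2) • x ^ (n + 2) := by
    rw [h0, hs.tsum_eq_zero_add, ((summable_nat_add_iff 1).2 hs).tsum_eq_zero_add]
    simp only [pow_zero, logSeriesCoeff_zero, zero_smul, zero_add, logSeriesCoeff_one, pow_one, one_smul, add_sub_cancel_left]
  have hgeom : HasSum (fun n : ℕ => ‖x‖ ^ (n + 2)) (‖x‖ ^ 2 / (1 - ‖x‖)) := by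
    simp_rw [pow_add, mul_comm _ (‖x‖ ^ 2)]
    rw [div_eq_mul_inv]
    exact (hasSum_geometric_of_lt_one (norm_nonneg x) hx1).mul_left (‖x‖ ^ 2)
  rw [h2]
  refine (tsum_of_norm_bounded hgeom fun n => norm_logSeriesCoeff_smul_pow_le x (n + 2)).trans ?_
  rw [div_le_iff₀ (by linarith)]
  nlinarith [norm_nonneg x, sq_nonneg ‖x‖]

omit [NormOneClass 𝔸] in
/-- `‖eˣ − 1‖ ≤ ‖x‖ + ‖x‖²` for `‖x‖ ≤ 1`. [cite: Balaban1985Averaging, (23)–(25) p.21 (series estimates)] -/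
theorem norm_exp_sub_one_le' {x : 𝔸} (hx : ‖x‖ ≤ 1) : ‖exp x - 1‖ ≤ ‖x‖ + ‖x‖ ^ 2 := by
  letI : NormedAlgebra ℝ 𝔸 := NormedAlgebra.restrictScalars ℝ ℂ 𝔸
  have h := OneLinkLaplace.norm_exp_sub_one_sub_le_sq hx
  calc ‖exp x - 1‖ = ‖(exp x - 1 - x) + x‖ := by rw [sub_add_cancel]
    _ ≤ ‖exp x - 1 - x‖ + ‖x‖ := norm_add_le _ _
    _ ≤ ‖x‖ + ‖x‖ ^ 2 := by linarith

omit [NormOneClass 𝔸] [NormedAlgebra ℂ 𝔸] [CompleteSpace 𝔸] in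
/-- **Weighted means with nonnegative weights of total mass one do not increase norms**: `‖Σ w_x z_x‖ ≤ M` if `‖z_x‖ ≤ M` on the block. [cite: Balaban1985Averaging, (78) p.30 (the weights `L⁻ᵈ`)] -/
theorem norm_wsum_le {ι : Type*} (t : Finset ι) {wt : ι → ℝ} (hw0 : ∀ x ∈ t, 0 ≤ wt x) (hw1 : ∑ x ∈ t, wt x = 1)
    {𝔹 : Type*} [SeminormedAddCommGroup 𝔹] [NormedSpace ℝ 𝔹] (z : ι → 𝔹) {M : ℝ} (hz : ∀ x ∈ t, ‖z x‖ ≤ M) :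
    ‖∑ x ∈ t, wt x • z x‖ ≤ M := by
  calc ‖∑ x ∈ t, wt x • z x‖ ≤ ∑ x ∈ t, ‖wt x • z x‖ := norm_sum_le _ _
    _ ≤ ∑ x ∈ t, wt x * M := Finset.sum_le_sum fun x hx => by
        rw [norm_smul, Real.norm_of_nonneg (hw0 x hx)]
        exact mul_le_mul_of_nonneg_left (hz x hx) (hw0 x hx)
    _ = M := by rw [← Finset.sum_mul, hw1, one_mul]

/-! ## §2  The two second-order estimates (logarithmic side, exponential side) -/

omit [NormOneClass 𝔸] [NormedAlgebra ℂ 𝔸] [CompleteSpace 𝔸] in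
/-- `‖a + b + c + d‖ ≤ ‖a‖ + ‖b‖ + ‖c‖ + ‖d‖`. [folklore] -/
private theorem norm_add₄_le (a b c d : 𝔸) : ‖a + b + c + d‖ ≤ ‖a‖ + ‖b‖ + ‖c‖ + ‖d‖ :=
  (norm_add_le _ _).trans (by linarith [norm_add₃_le (a := a) (b := b) (c := c)])

omit [NormOneClass 𝔸] in
/-- **Logarithmic side**: for families `α′, β` on the block with `‖α′_x‖ ≤ p`, `‖β_x‖ ≤ q`, `p, q ≤ 1∕8`, and `γ = α′ + β + α′β`:
`‖Σ w log(1+γ) − (Σ w log(1+α′) + Σ w log(1+β))‖ ≤ 5(p+q)²`. [cite: Balaban1985Averaging, (21) p.21, (78) p.30] -/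
theorem norm_wsum_log_cross_le {ι : Type*} (t : Finset ι) {wt : ι → ℝ} (hw0 : ∀ x ∈ t, 0 ≤ wt x) (hw1 : ∑ x ∈ t, wt x = 1)
    (α' β γ : ι → 𝔸) (hγ : ∀ x ∈ t, γ x = α' x + β x + α' x * β x) {p q : ℝ} (hp0 : 0 ≤ p) (hq0 : 0 ≤ q) (hp : p ≤ 1 / 8) (hq : q ≤ 1 / 8)
    (hα : ∀ x ∈ t, ‖α' x‖ ≤ p) (hβ : ∀ x ∈ t, ‖β x‖ ≤ q) :
    ‖(∑ x ∈ t, wt x • logOnePlus (γ x)) - ((∑ x ∈ t, wt x • logOnePlus (α' x)) + ∑ x ∈ t, wt x • logOnePlus (β x))‖ ≤ 5 * (p + q) ^ 2 := by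
  have hpq : p * q ≤ (p + q) ^ 2 / 4 := by nlinarith [sq_nonneg (p - q)]
  have hs4 : p + q ≤ 1 / 4 := by linarith
  have hγn : ∀ x ∈ t, ‖γ x‖ ≤ 17 / 16 * (p + q) := fun x hx => by
    rw [hγ x hx]
    calc ‖α' x + β x + α' x * β x‖ ≤ ‖α' x‖ + ‖β x‖ + ‖α' x * β x‖ := norm_add₃_le
      _ ≤ p + q + p * q := by
        gcongr
        · exact hα x hx
        · exact hβ x hx
        · exact (norm_mul_le _ _).trans (mul_le_mul (hα x hx) (hβ x hx) (norm_nonneg _) hp0)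
      _ ≤ 17 / 16 * (p + q) := by nlinarith
  have hγhalf : ∀ x ∈ t, ‖γ x‖ ≤ 1 / 2 := fun x hx => (hγn x hx).trans (by linarith)
  have hαhalf : ∀ x ∈ t, ‖α' x‖ ≤ 1 / 2 := fun x hx => (hα x hx).trans (by linarith)
  have hβhalf : ∀ x ∈ t, ‖β x‖ ≤ 1 / 2 := fun x hx => (hβ x hx).trans (by linarith)
  -- the difference is a weighted mean of `(log(1+γ) − γ) − (log(1+α′) − α′) − (log(1+β) − β) + α′β`
  have hrew : (∑ x ∈ t, wt x • logOnePlus (γ x)) - ((∑ x ∈ t, wt x • logOnePlus (α' x)) + ∑ x ∈ t, wt x • logOnePlus (β x)) =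
      ∑ x ∈ t, wt x • ((logOnePlus (γ x) - γ x) - (logOnePlus (α' x) - α' x) - (logOnePlus (β x) - β x) + α' x * β x) := by
    rw [← Finset.sum_add_distrib, ← Finset.sum_sub_distrib]
    refine Finset.sum_congr rfl fun x hx => ?_
    rw [← smul_add, ← smul_sub, hγ x hx]
    congr 1
    abel
  rw [hrew]
  refine norm_wsum_le t hw0 hw1 _ fun x hx => ?_
  calc ‖(logOnePlus (γ x) - γ x) - (logOnePlus (α' x) - α' x) - (logOnePlus (β x) - β x) + α' x * β x‖
      ≤ ‖logOnePlus (γ x) - γ x‖ + ‖logOnePlus (α' x) - α' x‖ + ‖logOnePlus (β x) - β x‖ + ‖α' x * β x‖ := by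
        have h := norm_add₄_le (logOnePlus (γ x) - γ x) (-(logOnePlus (α' x) - α' x)) (-(logOnePlus (β x) - β x)) (α' x * β x)
        rw [norm_neg, norm_neg] at h
        rw [sub_eq_add_neg, sub_eq_add_neg]
        exact h
    _ ≤ 2 * ‖γ x‖ ^ 2 + 2 * ‖α' x‖ ^ 2 + 2 * ‖β x‖ ^ 2 + p * q := by
        gcongr
        · exact norm_logOnePlus_sub_self_le (hγhalf x hx)
        · exact norm_logOnePlus_sub_self_le (hαhalf x hx)
        · exact norm_logOnePlus_sub_self_le (hβhalf x hx)
        · exact (norm_mul_le _ _).trans (mul_le_mul (hα x hx) (hβ x hx) (norm_nonneg _) hp0)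
    _ ≤ 2 * (17 / 16 * (p + q)) ^ 2 + 2 * p ^ 2 + 2 * q ^ 2 + p * q := by
        gcongr
        · exact hγn x hx
        · exact hα x hx
        · exact hβ x hx
    _ ≤ 5 * (p + q) ^ 2 := by nlinarith

/-- **Exponential side**: if `‖C − (A′ + B)‖ ≤ 5s²`, `‖C‖ ≤ (17∕8)s`, `‖A′‖ ≤ 2p`, `‖B‖ ≤ 2q`, `s = p + q ≤ 1∕4`, then `‖e^C − e^{A′}e^B‖ ≤ 16s²`
(`e^C − e^{A′}e^B = (e^C − 1 − C) + (C − A′ − B) − ((e^{A′} − 1 − A′)e^B + A′(e^B − 1) + (e^B − 1 − B))`). [cite: Balaban1985Averaging, (78) p.30, (23)–(25) p.21] -/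
theorem norm_exp_sub_exp_mul_exp_le (C A' B : 𝔸) {p q : ℝ} (hp0 : 0 ≤ p) (hq0 : 0 ≤ q) (hp : p ≤ 1 / 8) (hq : q ≤ 1 / 8)
    (hδ : ‖C - (A' + B)‖ ≤ 5 * (p + q) ^ 2) (hC : ‖C‖ ≤ 17 / 8 * (p + q)) (hA : ‖A'‖ ≤ 2 * p) (hB : ‖B‖ ≤ 2 * q) :
    ‖exp C - exp A' * exp B‖ ≤ 16 * (p + q) ^ 2 := by
  letI : NormedAlgebra ℝ 𝔸 := NormedAlgebra.restrictScalars ℝ ℂ 𝔸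
  have hC1 : ‖C‖ ≤ 1 := hC.trans (by linarith)
  have hA1 : ‖A'‖ ≤ 1 := hA.trans (by linarith)
  have hB1 : ‖B‖ ≤ 1 := hB.trans (by linarith)
  have hR1 : ‖exp C - 1 - C‖ ≤ 5 * (p + q) ^ 2 := by
    calc ‖exp C - 1 - C‖ ≤ ‖C‖ ^ 2 := OneLinkLaplace.norm_exp_sub_one_sub_le_sq hC1
      _ ≤ (17 / 8 * (p + q)) ^ 2 := by gcongr
      _ ≤ 5 * (p + q) ^ 2 := by nlinarith
  have hR2 : ‖exp A' - 1 - A'‖ ≤ 4 * p ^ 2 := by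
    calc ‖exp A' - 1 - A'‖ ≤ ‖A'‖ ^ 2 := OneLinkLaplace.norm_exp_sub_one_sub_le_sq hA1
      _ ≤ (2 * p) ^ 2 := by gcongr
      _ = 4 * p ^ 2 := by ring
  have hR3 : ‖exp B - 1 - B‖ ≤ 4 * q ^ 2 := by
    calc ‖exp B - 1 - B‖ ≤ ‖B‖ ^ 2 := OneLinkLaplace.norm_exp_sub_one_sub_le_sq hB1
      _ ≤ (2 * q) ^ 2 := by gcongr
      _ = 4 * q ^ 2 := by ring
  have hEB1 : ‖exp B - 1‖ ≤ 5 / 2 * q := by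
    calc ‖exp B - 1‖ ≤ ‖B‖ + ‖B‖ ^ 2 := norm_exp_sub_one_le' hB1
      _ ≤ 2 * q + (2 * q) ^ 2 := by gcongr
      _ ≤ 5 / 2 * q := by nlinarith
  have hEB : ‖exp B‖ ≤ 3 / 2 := by
    calc ‖exp B‖ = ‖(exp B - 1) + 1‖ := by rw [sub_add_cancel]
      _ ≤ ‖exp B - 1‖ + ‖(1 : 𝔸)‖ := norm_add_le _ _
      _ ≤ 5 / 2 * q + 1 := by rw [norm_one]; gcongr
      _ ≤ 3 / 2 := by linarith
  have hR4 : ‖exp A' * exp B - 1 - (A' + B)‖ ≤ 6 * (p + q) ^ 2 := by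
    have hrew : exp A' * exp B - 1 - (A' + B) = (exp A' - 1 - A') * exp B + A' * (exp B - 1) + (exp B - 1 - B) := by noncomm_ring
    rw [hrew]
    calc ‖(exp A' - 1 - A') * exp B + A' * (exp B - 1) + (exp B - 1 - B)‖
        ≤ ‖(exp A' - 1 - A') * exp B‖ + ‖A' * (exp B - 1)‖ + ‖exp B - 1 - B‖ := norm_add₃_le
      _ ≤ ‖exp A' - 1 - A'‖ * ‖exp B‖ + ‖A'‖ * ‖exp B - 1‖ + ‖exp B - 1 - B‖ := by
          gcongr <;> exact norm_mul_le _ _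
      _ ≤ 4 * p ^ 2 * (3 / 2) + 2 * p * (5 / 2 * q) + 4 * q ^ 2 := by gcongr
      _ ≤ 6 * (p + q) ^ 2 := by nlinarith
  have hrew : exp C - exp A' * exp B = (exp C - 1 - C) + (C - (A' + B)) + -(exp A' * exp B - 1 - (A' + B)) := by abel
  rw [hrew]
  calc ‖(exp C - 1 - C) + (C - (A' + B)) + -(exp A' * exp B - 1 - (A' + B))‖
      ≤ ‖exp C - 1 - C‖ + ‖C - (A' + B)‖ + ‖-(exp A' * exp B - 1 - (A' + B))‖ := norm_add₃_le
    _ ≤ 5 * (p + q) ^ 2 + 5 * (p + q) ^ 2 + 6 * (p + q) ^ 2 := by rw [norm_neg]; gcongr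
    _ = 16 * (p + q) ^ 2 := by ring

/-! ## §3  The one-step cross-term bound -/

omit [NormOneClass 𝔸] [NormedAlgebra ℂ 𝔸] [CompleteSpace 𝔸] in
/-- The algebra behind `(a(y)u(y))⁻¹a(x)u(x) = (1 + α′)(1 + β)`: with `VW = 1`, `W(Pu) = 1 + (W(P−1)V + (Wu − 1) + W(P−1)V(Wu − 1))`. [folklore] -/
private theorem cross_alg (W V P u : 𝔸) (hVW : V * W = 1) :
    W * (P * u) = 1 + (W * (P - 1) * V + (W * u - 1) + W * (P - 1) * V * (W * u - 1)) := by
  have h : 1 + (W * (P - 1) * V + (W * u - 1) + W * (P - 1) * V * (W * u - 1)) = W * u + W * (P - 1) * (V * W) * u := by noncomm_ring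
  rw [h, hVW]; noncomm_ring

/-- ★★★ **ONE (78)-STEP IS MULTIPLICATIVE UP TO SECOND ORDER** (trivial transporters, nonnegative weights of mass one): for `a, u` on a block with centre values `a(y), u(y)` — all of norm
`≤ 1` together with their inverses (`U1`) — and oscillations `‖a(y)⁻¹a(x) − 1‖ ≤ p`, `‖u(y)⁻¹u(x) − 1‖ ≤ q`, `p, q ≤ 1∕8`:
`‖R̄₀(a·u)(y) − R̄₀(a)(y)·R̄₀(u)(y)‖ ≤ 16·(p + q)²`.  (Road (B′): `a = g_sr·X⁻¹` with `R̄₀(a) = 1`, `u = u₀` with `R̄₀(u₀) = 1` ⇒ `‖R̄₀(a·u₀) − 1‖ ≤ 16(p+q)²` = the displayed `ψ₂`,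
ε²-type since `p = O(θ_j)` and `q = O(κε_j)` are ε-type.) [cite: Balaban1985Averaging, (78) p.30, (21) p.21; Balaban1985Variational, (100) p.47] -/
theorem norm_avgStep_mul_sub_mul_le {ι : Type*} (t : Finset ι) {wt : ι → ℝ} (hw0 : ∀ x ∈ t, 0 ≤ wt x) (hw1 : ∑ x ∈ t, wt x = 1)
    {T : ι → 𝔸ˣ} (hT : ∀ x ∈ t, T x = 1) (ay uy : 𝔸ˣ)
    (hay : ‖(ay : 𝔸)‖ ≤ 1) (huy : ‖(uy : 𝔸)‖ ≤ 1) (huy' : ‖((uy⁻¹ : 𝔸ˣ) : 𝔸)‖ ≤ 1)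
    (a u : ι → 𝔸) {p q : ℝ} (hp0 : 0 ≤ p) (hq0 : 0 ≤ q) (hp : p ≤ 1 / 8) (hq : q ≤ 1 / 8)
    (hpa : ∀ x ∈ t, ‖((ay⁻¹ : 𝔸ˣ) : 𝔸) * a x - 1‖ ≤ p) (hqu : ∀ x ∈ t, ‖((uy⁻¹ : 𝔸ˣ) : 𝔸) * u x - 1‖ ≤ q) :
    ‖avgStep t wt T ((ay * uy : 𝔸ˣ) : 𝔸) (fun x => a x * u x) - avgStep t wt T (ay : 𝔸) a * avgStep t wt T (uy : 𝔸) u‖ ≤ 16 * (p + q) ^ 2 := by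
  letI : NormedAlgebra ℚ 𝔸 := NormedAlgebra.restrictScalars ℚ ℂ 𝔸
  -- opaque names for the deviations
  obtain ⟨α, hα⟩ : ∃ α : ι → 𝔸, ∀ x, α x = ((ay⁻¹ : 𝔸ˣ) : 𝔸) * a x - 1 := ⟨_, fun _ => rfl⟩
  obtain ⟨β, hβ⟩ : ∃ β : ι → 𝔸, ∀ x, β x = ((uy⁻¹ : 𝔸ˣ) : 𝔸) * u x - 1 := ⟨_, fun _ => rfl⟩
  obtain ⟨α', hα'⟩ : ∃ α' : ι → 𝔸, ∀ x, α' x = ((uy⁻¹ : 𝔸ˣ) : 𝔸) * α x * (uy : 𝔸) := ⟨_, fun _ => rfl⟩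
  obtain ⟨γ, hγ⟩ : ∃ γ : ι → 𝔸, ∀ x, γ x = α' x + β x + α' x * β x := ⟨_, fun _ => rfl⟩
  have hαn : ∀ x ∈ t, ‖α x‖ ≤ p := fun x hx => by rw [hα]; exact hpa x hx
  have hβn : ∀ x ∈ t, ‖β x‖ ≤ q := fun x hx => by rw [hβ]; exact hqu x hx
  have hα'n : ∀ x ∈ t, ‖α' x‖ ≤ p := fun x hx => by
    rw [hα']
    calc ‖((uy⁻¹ : 𝔸ˣ) : 𝔸) * α x * (uy : 𝔸)‖ ≤ ‖((uy⁻¹ : 𝔸ˣ) : 𝔸)‖ * ‖α x‖ * ‖(uy : 𝔸)‖ :=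
          (norm_mul_le _ _).trans (mul_le_mul_of_nonneg_right (norm_mul_le _ _) (norm_nonneg _))
      _ ≤ 1 * p * 1 := by
          gcongr
          exact hαn x hx
      _ = p := by ring
  have hmlog : ∀ z : 𝔸, mlog (1 + z) = logOnePlus z := fun z => by rw [mlog_def, add_sub_cancel_left]
  have huu : (uy : 𝔸) * ((uy⁻¹ : 𝔸ˣ) : 𝔸) = 1 := Units.mul_inv uy
  have huu' : ((uy⁻¹ : 𝔸ˣ) : 𝔸) * (uy : 𝔸) = 1 := Units.inv_mul uy
  -- the three (78) exponents
  have hkeyC : ∀ x ∈ t, Ring.inverse ((ay * uy : 𝔸ˣ) : 𝔸) * conjR (T x) (a x * u x) = 1 + γ x := by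
    intro x hx
    rw [Ring.inverse_unit, hT x hx, conjR_apply, Units.val_one, inv_one, Units.val_one, one_mul, mul_one, mul_inv_rev, Units.val_mul,
      hγ, hα', hβ, hα]
    rw [show ((uy⁻¹ : 𝔸ˣ) : 𝔸) * ((ay⁻¹ : 𝔸ˣ) : 𝔸) * (a x * u x) = ((uy⁻¹ : 𝔸ˣ) : 𝔸) * ((((ay⁻¹ : 𝔸ˣ) : 𝔸) * a x) * u x) by noncomm_ring]
    exact cross_alg _ _ _ _ huu
  have hkeyA : ∀ x ∈ t, Ring.inverse (ay : 𝔸) * conjR (T x) (a x) = 1 + α x := by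
    intro x hx
    rw [Ring.inverse_unit, hT x hx, conjR_apply, Units.val_one, inv_one, Units.val_one, one_mul, mul_one, hα, add_sub_cancel]
  have hkeyB : ∀ x ∈ t, Ring.inverse (uy : 𝔸) * conjR (T x) (u x) = 1 + β x := by
    intro x hx
    rw [Ring.inverse_unit, hT x hx, conjR_apply, Units.val_one, inv_one, Units.val_one, one_mul, mul_one, hβ, add_sub_cancel]
  have hLHS : avgStep t wt T ((ay * uy : 𝔸ˣ) : 𝔸) (fun x => a x * u x) = ((ay * uy : 𝔸ˣ) : 𝔸) * exp (∑ x ∈ t, wt x • logOnePlus (γ x)) := by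
    rw [avgStep_eq_mul_exp_sum]
    congr 2
    exact Finset.sum_congr rfl fun x hx => by rw [hkeyC x hx, hmlog]
  have hRa : avgStep t wt T (ay : 𝔸) a = (ay : 𝔸) * exp (∑ x ∈ t, wt x • logOnePlus (α x)) := by
    rw [avgStep_eq_mul_exp_sum]
    congr 2
    exact Finset.sum_congr rfl fun x hx => by rw [hkeyA x hx, hmlog]
  have hRu : avgStep t wt T (uy : 𝔸) u = (uy : 𝔸) * exp (∑ x ∈ t, wt x • logOnePlus (β x)) := by
    rw [avgStep_eq_mul_exp_sum]
    congr 2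
    exact Finset.sum_congr rfl fun x hx => by rw [hkeyB x hx, hmlog]
  -- conjugating `A` by `uy⁻¹` gives the `α′`-series exactly
  have hA' : ((uy⁻¹ : 𝔸ˣ) : 𝔸) * (∑ x ∈ t, wt x • logOnePlus (α x)) * (uy : 𝔸) = ∑ x ∈ t, wt x • logOnePlus (α' x) := by
    rw [Finset.mul_sum, Finset.sum_mul]
    refine Finset.sum_congr rfl fun x _ => ?_
    rw [mul_smul_comm, smul_mul_assoc, hα']
    congr 1
    have h := B7Prop6Flat.logOnePlus_conj uy⁻¹ (α x)
    rw [inv_inv] at h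
    exact h.symm
  -- sizes
  have hs4 : p + q ≤ 1 / 4 := by linarith
  have hCn : ‖∑ x ∈ t, wt x • logOnePlus (γ x)‖ ≤ 17 / 8 * (p + q) := by
    have hγn : ∀ x ∈ t, ‖γ x‖ ≤ 17 / 16 * (p + q) := fun x hx => by
      rw [hγ]
      calc ‖α' x + β x + α' x * β x‖ ≤ ‖α' x‖ + ‖β x‖ + ‖α' x * β x‖ := norm_add₃_le
        _ ≤ p + q + p * q := by
          gcongr
          · exact hα'n x hx
          · exact hβn x hx
          · exact (norm_mul_le _ _).trans (mul_le_mul (hα'n x hx) (hβn x hx) (norm_nonneg _) hp0)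
        _ ≤ 17 / 16 * (p + q) := by nlinarith [sq_nonneg (p - q)]
    refine norm_wsum_le t hw0 hw1 _ fun x hx => ?_
    have hh : ‖γ x‖ ≤ 1 / 2 := (hγn x hx).trans (by linarith)
    exact (norm_logOnePlus_le_two_mul hh).trans (by linarith [hγn x hx])
  have hAn : ‖∑ x ∈ t, wt x • logOnePlus (α' x)‖ ≤ 2 * p :=
    norm_wsum_le t hw0 hw1 _ fun x hx => (norm_logOnePlus_le_two_mul ((hα'n x hx).trans (by linarith))).trans (by linarith [hα'n x hx])
  have hBn : ‖∑ x ∈ t, wt x • logOnePlus (β x)‖ ≤ 2 * q :=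
    norm_wsum_le t hw0 hw1 _ fun x hx => (norm_logOnePlus_le_two_mul ((hβn x hx).trans (by linarith))).trans (by linarith [hβn x hx])
  have hδ := norm_wsum_log_cross_le t hw0 hw1 α' β γ (fun x _ => hγ x) hp0 hq0 hp hq hα'n hβn
  have hmain := norm_exp_sub_exp_mul_exp_le _ _ _ hp0 hq0 hp hq hδ hCn hAn hBn
  -- assemble
  have hRHS : (ay : 𝔸) * exp (∑ x ∈ t, wt x • logOnePlus (α x)) * ((uy : 𝔸) * exp (∑ x ∈ t, wt x • logOnePlus (β x))) =
      (ay : 𝔸) * (uy : 𝔸) * (exp (∑ x ∈ t, wt x • logOnePlus (α' x)) * exp (∑ x ∈ t, wt x • logOnePlus (β x))) := by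
    rw [← hA', NormedSpace.exp_units_conj']
    calc (ay : 𝔸) * exp (∑ x ∈ t, wt x • logOnePlus (α x)) * ((uy : 𝔸) * exp (∑ x ∈ t, wt x • logOnePlus (β x)))
        = (ay : 𝔸) * ((uy : 𝔸) * ((uy⁻¹ : 𝔸ˣ) : 𝔸)) * exp (∑ x ∈ t, wt x • logOnePlus (α x)) *
            ((uy : 𝔸) * exp (∑ x ∈ t, wt x • logOnePlus (β x))) := by rw [huu, mul_one]
      _ = _ := by noncomm_ring
  rw [hLHS, hRa, hRu, hRHS, Units.val_mul, ← mul_sub]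
  calc ‖(ay : 𝔸) * (uy : 𝔸) * (exp (∑ x ∈ t, wt x • logOnePlus (γ x)) -
          exp (∑ x ∈ t, wt x • logOnePlus (α' x)) * exp (∑ x ∈ t, wt x • logOnePlus (β x)))‖
      ≤ ‖(ay : 𝔸)‖ * ‖(uy : 𝔸)‖ * ‖exp (∑ x ∈ t, wt x • logOnePlus (γ x)) -
          exp (∑ x ∈ t, wt x • logOnePlus (α' x)) * exp (∑ x ∈ t, wt x • logOnePlus (β x))‖ :=
        (norm_mul_le _ _).trans (mul_le_mul_of_nonneg_right (norm_mul_le _ _) (norm_nonneg _))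
    _ ≤ 1 * 1 * (16 * (p + q) ^ 2) := by gcongr
    _ = 16 * (p + q) ^ 2 := by ring

end Literature.MathematicalPhysics.QuantumFieldTheory.Balaban1983to89.B8ExpMeanLogCrossTermRec
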